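import Mathlib.NumberTheory.Real.Irrational
import Mathlib.Analysis.SpecialFunctions.Pow.Real
import Mathlib.LinearAlgebra.Dimension.Constructions
import Literature.NumberTheory.Transcendental.PeriodsWave0
import HarnessLib

/-!
# Linear independence of `0.21 √(s / log s)` odd zeta values (Fischler 2026)

Topic `Literature/NumberTheory/Irrationality/Fischler2026`. Typed, cited statement (no proof) of
Theorem 1 of S. Fischler, *Linear independence of odd zeta values using Siegel's lemma*, J. London
Math. Soc. (2) **113**:4 (2026), doi:10.1112/jlms.70535 = arXiv:2109.10136 [Fischler2026]. PRIMARY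
SOURCE read on the page (held: `paper:arxiv-2109.10136`, §1): "**Theorem 1.** For any sufficiently
large odd integer `s` we have:
`dim_ℚ Span_ℚ(1, ζ(3), ζ(5), …, ζ(s)) ≥ 0.21 √s / √(log s)`.
Here `0.21` is the rounded value of a real number that we did not try to compute exactly. As a
corollary, there are at least `0.21 √s/√(log s)` irrational numbers among `ζ(3), ζ(5), …, ζ(s)`. This
corollary was proved recently by Lai and Yu [LaiYu] with a better numerical constant, namely `1.19…`
instead of `0.21`." The rounding is DOWNWARD, so the displayed inequality is what is proved: "In
Theorem 1 the numerical constant `0.21` can be replaced (as the proof will show) by a slightly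
larger real number" (§ proof of Thm 1, arXiv p. 19: `1 - log α/log β ∼ 0.25 √(a/log a)`). Method:
non-explicit linear forms from Siegel's lemma and a Siegel-type linear independence criterion in
place of Nesterenko's (§1). It improves Ball–Rivoal's `(1-ε) log s/(1 + log 2)` (tree, PROVED:
`Literature.NumberTheory.Transcendental.ball_rivoal`) for large `s`.

Rendering (same span as the tree's `ball_rivoal`):
`Span_ℚ(insert 1 {ζ(k) : k odd, 3 ≤ k ≤ s})`, `ζ(k) = zetaValue k`; "sufficiently large" as
`∃ s₀, ∀ s ≥ s₀`; `√` as `Real.sqrt`.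

Cell pub-zeta5 (HONEST FRAMING: systematic search; no irrationality claim unless certified): the
RECORD of the linear-independence COUNT for the lane `fam-indep` (FRESHNESS §1.2); nothing here
bears on `ζ(5)` itself ("there is still no odd `s ≥ 5` for which `ζ(s)` is known to be irrational",
ibid. §1).
-/

noncomputable section

namespace Literature.NumberTheory.Irrationality.Fischler2026

open Literature.NumberTheory.Transcendental (zetaValue)

/-- **Fischler 2026, Theorem 1** (named fact, statement only): for every sufficiently large odd `s`,
`dim_ℚ Span_ℚ(1, ζ(3), ζ(5), …, ζ(s)) ≥ 0.21 √s / √(log s)`.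
[cite: Fischler2026, §1 Theorem 1 (arXiv:2109.10136 p. 2; constant 0.21 rounded down, proof of Thm 1 p. 19)] -/
def oddZetaSpan_finrank_ge_sqrt : Prop :=
  ∃ s₀ : ℕ, ∀ s : ℕ, s₀ ≤ s → Odd s →
    (0.21 : ℝ) * Real.sqrt s / Real.sqrt (Real.log s) ≤
      Module.finrank ℚ
        ↥(Submodule.span ℚ
          (insert (1 : ℝ) {x | ∃ k : ℕ, Odd k ∧ 3 ≤ k ∧ k ≤ s ∧ x = zetaValue k}))

end Literature.NumberTheory.Irrationality.Fischler2026
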